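import Summits.QuantumFields.GaugeBoot.FluctuationAppend
import HarnessLib

/-!
# Fluctuations of Wilson loops, III: merger sums of concatenated loop sequences (gauge-boot, ADDENDUM 32 part C)

HONEST FRAMING (cell `pub-gaugeboot`, page 1 of every file): the venture produces certified bounds
on lattice expectations at stated coupling, gauge group, dimension and torus size; NOT a mass gap,
NOT a continuum limit, NOT a string tension; NOT Yang–Mills-summit-bearing (barriers
`FixedCouplingUltralocality`, `PerturbativeInvisibility`).  Strong-coupling `SO(N)` lattice gauge theory with free boundary
condition (S. Chatterjee, Comm. Math. Phys. **366** (2019); S. Chatterjee, J. Jafarov, arXiv:1604.04777); nothing about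
four-dimensional continuum Yang–Mills or a mass gap.

## Content

The merger sums of the tree (`MergeIdx s`: ordered pairs of distinct components with matching undirected edges; the merged loop
replaces the first operand, the second is deleted) written as a double component sum (`sum_mergeAt_comp`), the double
component sum of `w :: t` (`pairSum_cons`) and of a concatenation `A ++ B` of null-free loop sequences (`pairSum_append`):
mergers inside `A`, inside `B`, and the two kinds of CROSS mergers (first operand in `A` / in `B`), and the resulting
decomposition of `Σ_{𝕄^±(A ++ B)}` (`sum_negMergeAt_append`, `sum_posMergeAt_append`).  This is the bookkeeping behind the
`1/N²` merger terms of the loop equations for centered products of Wilson loop variables.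

Everything is `[folklore]` (list bookkeeping).
-/

noncomputable section

open Finset
open Literature.MathematicalPhysics.QuantumFieldTheory.Chatterjee2019LargeN
open Literature.MathematicalPhysics.QuantumFieldTheory.Chatterjee2019LargeN.Word

namespace Summit.QuantumFields.GaugeBoot

namespace StringDuality

variable {d : ℕ} {M : Type*} [AddCommMonoid M]

/-! ## Merger sums as double component sums -/

/-- The tree's merger sums over `MergeIdx s`, as a double sum over ordered pairs of components `(i, j)`, `i ≠ j`, and pairs of
locations with matching undirected edges; `mrg` is the merged word (`Word.negMerge` or `Word.posMerge`).
[cite: Chatterjee2019LargeN, §2.2 (𝕄⁺(s), 𝕄⁻(s): counting of mergers)] -/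
theorem sum_mergeAt_comp (mrg : (w : List (DEdge d)) → Fin w.length → (w' : List (DEdge d)) → Fin w'.length → List (DEdge d))
    (f : LoopSeq d → M) (s : LoopSeq d) :
    ∑ o : MergeIdx s, f (LoopSeq.prune ((s.set o.1 (mrg (s.get o.1) o.2.2.1.1 (s.get o.2.1) o.2.2.1.2)).eraseIdx o.2.1)) =
      ∑ i : Fin s.length, ∑ j : Fin s.length, if i = j then 0 else
        ∑ q : {xy : Fin (s.get i).length × Fin (s.get j).length // ((s.get j).get xy.2).1 = ((s.get i).get xy.1).1},
          f (LoopSeq.prune ((s.set i (mrg (s.get i) q.1.1 (s.get j) q.1.2)).eraseIdx j)) := by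
  rw [Fintype.sum_sigma]
  refine Finset.sum_congr rfl fun i _ => ?_
  rw [Fintype.sum_sigma]
  refine Finset.sum_congr rfl fun j _ => ?_
  split_ifs with h
  · subst h
    haveI : IsEmpty {xy : Fin (s.get i).length × Fin (s.get i).length //
        i ≠ i ∧ ((s.get i).get xy.2).1 = ((s.get i).get xy.1).1} := ⟨fun q => q.2.1 rfl⟩
    exact Fintype.sum_empty _
  · exact Fintype.sum_equiv (Equiv.subtypeEquivRight fun xy => by simp [h]) _ _ fun q => rfl

/-! ## The double component sum of `w :: t` and of `A ++ B` -/

section pair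

variable (mrg : (w : List (DEdge d)) → Fin w.length → (w' : List (DEdge d)) → Fin w'.length → List (DEdge d))

/-- The double component (merger) sum of `w :: t`: head–tail pairs, tail–head pairs, and tail–tail pairs (head kept in front).
[folklore] -/
theorem pairSum_cons (f : LoopSeq d → M) (w : List (DEdge d)) (t : LoopSeq d) :
    (∑ i : Fin (w :: t).length, ∑ j : Fin (w :: t).length, if i = j then 0 else
        ∑ q : {xy : Fin ((w :: t).get i).length × Fin ((w :: t).get j).length //
            (((w :: t).get j).get xy.2).1 = (((w :: t).get i).get xy.1).1},
          f (LoopSeq.prune (((w :: t).set i (mrg _ q.1.1 _ q.1.2)).eraseIdx j))) =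
      (∑ j : Fin t.length, ∑ q : {xy : Fin w.length × Fin (t.get j).length // ((t.get j).get xy.2).1 = (w.get xy.1).1},
          f (LoopSeq.prune (mrg w q.1.1 (t.get j) q.1.2 :: t.eraseIdx j)))
      + (∑ i : Fin t.length, ∑ q : {xy : Fin (t.get i).length × Fin w.length // (w.get xy.2).1 = ((t.get i).get xy.1).1},
          f (LoopSeq.prune (t.set i (mrg (t.get i) q.1.1 w q.1.2))))
      + ∑ i : Fin t.length, ∑ j : Fin t.length, if i = j then 0 else
        ∑ q : {xy : Fin (t.get i).length × Fin (t.get j).length // ((t.get j).get xy.2).1 = ((t.get i).get xy.1).1},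
          f (LoopSeq.prune (w :: (t.set i (mrg _ q.1.1 _ q.1.2)).eraseIdx j)) := by
  -- peel `i = 0`
  refine (Fin.sum_univ_succ (fun i : Fin (t.length + 1) => ∑ j : Fin (w :: t).length, if i = j then 0 else
        ∑ q : {xy : Fin ((w :: t).get i).length × Fin ((w :: t).get j).length //
            (((w :: t).get j).get xy.2).1 = (((w :: t).get i).get xy.1).1},
          f (LoopSeq.prune (((w :: t).set i (mrg _ q.1.1 _ q.1.2)).eraseIdx j)))).trans ?_
  rw [add_assoc]
  congr 1
  · -- `i = 0`: peel `j = 0` (no term) and `j = j' + 1`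
    refine (Fin.sum_univ_succ (fun j : Fin (t.length + 1) => if (0 : Fin (t.length + 1)) = j then 0 else
        ∑ q : {xy : Fin ((w :: t).get 0).length × Fin ((w :: t).get j).length //
            (((w :: t).get j).get xy.2).1 = (((w :: t).get 0).get xy.1).1},
          f (LoopSeq.prune (((w :: t).set 0 (mrg _ q.1.1 _ q.1.2)).eraseIdx j)))).trans ?_
    rw [if_pos rfl, zero_add]
    refine Finset.sum_congr rfl fun j _ => ?_
    rw [if_neg (fun h => Fin.succ_ne_zero j h.symm)]
    rfl
  · -- `i = i' + 1`
    rw [← Finset.sum_add_distrib]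
    refine Finset.sum_congr rfl fun i _ => ?_
    refine (Fin.sum_univ_succ (fun j : Fin (t.length + 1) => if i.succ = j then 0 else
        ∑ q : {xy : Fin ((w :: t).get i.succ).length × Fin ((w :: t).get j).length //
            (((w :: t).get j).get xy.2).1 = (((w :: t).get i.succ).get xy.1).1},
          f (LoopSeq.prune (((w :: t).set i.succ (mrg _ q.1.1 _ q.1.2)).eraseIdx j)))).trans ?_
    rw [if_neg (Fin.succ_ne_zero i)]
    congr 1
    refine Finset.sum_congr rfl fun j _ => ?_
    by_cases hij : i = j
    · subst hij
      rw [if_pos rfl, if_pos rfl]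
    · rw [if_neg (fun h => hij (Fin.succ_inj.mp h)), if_neg hij]
      rfl

/-- Pruning a cons with a null-free tail. [folklore] -/
theorem prune_cons_eq (m : List (DEdge d)) {u : LoopSeq d} (hu : ∀ l ∈ u, l ≠ []) :
    LoopSeq.prune (m :: u) = LoopSeq.prune [m] ++ u := by
  have h : LoopSeq.prune (m :: u) = LoopSeq.prune [m] ++ LoopSeq.prune u := by
    unfold LoopSeq.prune
    rw [← List.filter_append]
    rfl
  rw [h, LoopSeq.prune_eq_self hu]

/-- Pruning a cons with a non-null head. [folklore] -/
theorem prune_cons_of_ne_nil {w : List (DEdge d)} (hw : w ≠ []) (u : LoopSeq d) :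
    LoopSeq.prune (w :: u) = w :: LoopSeq.prune u := by
  unfold LoopSeq.prune
  simp [hw]

/-- Erasing a component keeps a loop sequence null-free. [folklore] -/
theorem eraseIdx_ne_nil_of {u : LoopSeq d} (hu : ∀ l ∈ u, l ≠ []) (j : ℕ) : ∀ l ∈ u.eraseIdx j, l ≠ [] :=
  fun l hl => hu l (List.mem_of_mem_eraseIdx hl)

/-- Setting a component and pruning: `prune (u.set i m) = take i u ++ prune [m] ++ drop (i+1) u` for null-free `u` and
`i < |u|`. [folklore] -/
theorem prune_set_eq {u : LoopSeq d} (hu : ∀ l ∈ u, l ≠ []) (i : Fin u.length) (m : List (DEdge d)) :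
    LoopSeq.prune (u.set i m) = u.take i ++ LoopSeq.prune [m] ++ u.drop (i + 1) := by
  rw [List.set_eq_take_append_cons_drop, if_pos i.isLt]
  have h1 : LoopSeq.prune (u.take i ++ m :: u.drop (i + 1)) =
      LoopSeq.prune (u.take i) ++ (LoopSeq.prune [m] ++ LoopSeq.prune (u.drop (i + 1))) := by
    unfold LoopSeq.prune
    rw [List.filter_append, show m :: u.drop (i + 1) = [m] ++ u.drop (i + 1) from rfl, List.filter_append]
  rw [h1, LoopSeq.prune_eq_self (fun l hl => hu l (List.mem_of_mem_take hl)),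
    LoopSeq.prune_eq_self (fun l hl => hu l (List.mem_of_mem_drop hl)), List.append_assoc]

omit mrg in
/-- One-component sums of `A ++ B` where the component is ERASED (second operand of a cross merger). [folklore] -/
theorem compSum_eraseIdx_append (ι : List (DEdge d) → Type) [∀ w, Fintype (ι w)]
    (Φ : (w : List (DEdge d)) → ι w → LoopSeq d → M) (A B : LoopSeq d) :
    (∑ i : Fin (A ++ B).length, ∑ q : ι ((A ++ B).get i), Φ _ q ((A ++ B).eraseIdx i)) =
      (∑ i : Fin A.length, ∑ q : ι (A.get i), Φ _ q (A.eraseIdx i ++ B)) +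
        ∑ i : Fin B.length, ∑ q : ι (B.get i), Φ _ q (A ++ B.eraseIdx i) := by
  have h := compSum_append ι (fun _ _ => ([] : LoopSeq d)) Φ A B
  simpa only [List.append_nil, ← List.eraseIdx_eq_take_drop_succ] using h

variable {A B : LoopSeq d} (hA : ∀ l ∈ A, l ≠ []) (hB : ∀ l ∈ B, l ≠ [])
include hA hB

/-- ★ The double component (merger) sum of a concatenation `A ++ B` of null-free loop sequences: pairs inside `A` (with `B`
appended to the result), pairs inside `B` (with `A` prepended), cross pairs with the first operand in `A` (the merged loop
replaces it, the second operand is deleted from `B`), and cross pairs with the first operand in `B`. [folklore] -/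
theorem pairSum_append (f : LoopSeq d → M) :
    (∑ i : Fin (A ++ B).length, ∑ j : Fin (A ++ B).length, if i = j then 0 else
        ∑ q : {xy : Fin ((A ++ B).get i).length × Fin ((A ++ B).get j).length //
            (((A ++ B).get j).get xy.2).1 = (((A ++ B).get i).get xy.1).1},
          f (LoopSeq.prune (((A ++ B).set i (mrg _ q.1.1 _ q.1.2)).eraseIdx j))) =
      (∑ i : Fin A.length, ∑ j : Fin A.length, if i = j then 0 else
        ∑ q : {xy : Fin (A.get i).length × Fin (A.get j).length // ((A.get j).get xy.2).1 = ((A.get i).get xy.1).1},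
          f (LoopSeq.prune ((A.set i (mrg _ q.1.1 _ q.1.2)).eraseIdx j) ++ B))
      + (∑ i : Fin B.length, ∑ j : Fin B.length, if i = j then 0 else
        ∑ q : {xy : Fin (B.get i).length × Fin (B.get j).length // ((B.get j).get xy.2).1 = ((B.get i).get xy.1).1},
          f (A ++ LoopSeq.prune ((B.set i (mrg _ q.1.1 _ q.1.2)).eraseIdx j)))
      + (∑ i : Fin A.length, ∑ j : Fin B.length,
        ∑ q : {xy : Fin (A.get i).length × Fin (B.get j).length // ((B.get j).get xy.2).1 = ((A.get i).get xy.1).1},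
          f (A.take i ++ LoopSeq.prune [mrg _ q.1.1 _ q.1.2] ++ A.drop (i + 1) ++ B.eraseIdx j))
      + ∑ j : Fin B.length, ∑ i : Fin A.length,
        ∑ q : {xy : Fin (B.get j).length × Fin (A.get i).length // ((A.get i).get xy.2).1 = ((B.get j).get xy.1).1},
          f (A.eraseIdx i ++ (B.take j ++ LoopSeq.prune [mrg _ q.1.1 _ q.1.2] ++ B.drop (j + 1))) := by
  induction A generalizing f with
  | nil =>
    have h1 : (∑ i : Fin ([] : LoopSeq d).length, ∑ j : Fin ([] : LoopSeq d).length, if i = j then (0 : M) else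
        ∑ q : {xy : Fin (([] : LoopSeq d).get i).length × Fin (([] : LoopSeq d).get j).length //
            ((([] : LoopSeq d).get j).get xy.2).1 = ((([] : LoopSeq d).get i).get xy.1).1},
          f (LoopSeq.prune ((([] : LoopSeq d).set i (mrg _ q.1.1 _ q.1.2)).eraseIdx j) ++ B)) = 0 := Fin.sum_univ_zero _
    have h2 : (∑ i : Fin ([] : LoopSeq d).length, ∑ j : Fin B.length,
        ∑ q : {xy : Fin (([] : LoopSeq d).get i).length × Fin (B.get j).length //
            ((B.get j).get xy.2).1 = ((([] : LoopSeq d).get i).get xy.1).1},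
          f (([] : LoopSeq d).take i ++ LoopSeq.prune [mrg _ q.1.1 _ q.1.2] ++ ([] : LoopSeq d).drop (i + 1) ++ B.eraseIdx j)) = 0 :=
      Fin.sum_univ_zero _
    have h3 : ∀ j : Fin B.length, (∑ i : Fin ([] : LoopSeq d).length,
        ∑ q : {xy : Fin (B.get j).length × Fin (([] : LoopSeq d).get i).length //
            ((([] : LoopSeq d).get i).get xy.2).1 = ((B.get j).get xy.1).1},
          f (([] : LoopSeq d).eraseIdx i ++ (B.take j ++ LoopSeq.prune [mrg _ q.1.1 _ q.1.2] ++ B.drop (j + 1)))) = 0 :=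
      fun j => Fin.sum_univ_zero _
    rw [h1, h2, Finset.sum_congr rfl fun j _ => h3 j, Finset.sum_const_zero, zero_add, add_zero, add_zero]
    rfl
  | cons w A ih =>
    have hA' : ∀ l ∈ A, l ≠ [] := fun l hl => hA l (List.mem_cons_of_mem w hl)
    have hw : w ≠ [] := hA w (by simp)
    have hAB : ∀ l ∈ A ++ B, l ≠ [] := append_ne_nil_of hA' hB
    -- the three pieces of `pairSum_cons` for `w :: (A ++ B)` and for `w :: A`
    have h1 := pairSum_cons mrg f w (A ++ B)
    have h2 := pairSum_cons mrg (fun u => f (u ++ B)) w A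
    have h3 := ih hA' (fun u => f (w :: u))
    refine h1.trans ?_
    -- head–tail pairs of `w :: (A ++ B)`
    have e1 := compSum_eraseIdx_append (fun w' => {xy : Fin w.length × Fin w'.length // (w'.get xy.2).1 = (w.get xy.1).1})
      (fun w' q u => f (LoopSeq.prune [mrg w q.1.1 w' q.1.2] ++ u)) A B
    -- tail–head pairs of `w :: (A ++ B)`
    have e2 := compSum_append (fun w' => {xy : Fin w'.length × Fin w.length // (w.get xy.2).1 = (w'.get xy.1).1})
      (fun w' q => LoopSeq.prune [mrg w' q.1.1 w q.1.2]) (fun _ _ u => f u) A B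
    -- rewrite the head–tail / tail–head sums of the left side into the `take/drop` form
    have l1 : (∑ j : Fin (A ++ B).length, ∑ q : {xy : Fin w.length × Fin ((A ++ B).get j).length //
          (((A ++ B).get j).get xy.2).1 = (w.get xy.1).1}, f (LoopSeq.prune (mrg w q.1.1 ((A ++ B).get j) q.1.2 :: (A ++ B).eraseIdx j)))
        = ∑ j : Fin (A ++ B).length, ∑ q : {xy : Fin w.length × Fin ((A ++ B).get j).length //
          (((A ++ B).get j).get xy.2).1 = (w.get xy.1).1},
            f (LoopSeq.prune [mrg w q.1.1 ((A ++ B).get j) q.1.2] ++ (A ++ B).eraseIdx j) := by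
      refine Finset.sum_congr rfl fun j _ => Finset.sum_congr rfl fun q _ => ?_
      rw [prune_cons_eq _ (eraseIdx_ne_nil_of hAB j)]
    have l2 : (∑ i : Fin (A ++ B).length, ∑ q : {xy : Fin ((A ++ B).get i).length × Fin w.length //
          (w.get xy.2).1 = (((A ++ B).get i).get xy.1).1}, f (LoopSeq.prune ((A ++ B).set i (mrg ((A ++ B).get i) q.1.1 w q.1.2))))
        = ∑ i : Fin (A ++ B).length, ∑ q : {xy : Fin ((A ++ B).get i).length × Fin w.length //
          (w.get xy.2).1 = (((A ++ B).get i).get xy.1).1},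
            f ((A ++ B).take i ++ LoopSeq.prune [mrg ((A ++ B).get i) q.1.1 w q.1.2] ++ (A ++ B).drop (i + 1)) := by
      refine Finset.sum_congr rfl fun i _ => Finset.sum_congr rfl fun q _ => ?_
      rw [prune_set_eq hAB]
    -- the same for `w :: A` (right side)
    have r1 : (∑ j : Fin A.length, ∑ q : {xy : Fin w.length × Fin (A.get j).length // ((A.get j).get xy.2).1 = (w.get xy.1).1},
          f (LoopSeq.prune (mrg w q.1.1 (A.get j) q.1.2 :: A.eraseIdx j) ++ B))
        = ∑ j : Fin A.length, ∑ q : {xy : Fin w.length × Fin (A.get j).length // ((A.get j).get xy.2).1 = (w.get xy.1).1},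
            f (LoopSeq.prune [mrg w q.1.1 (A.get j) q.1.2] ++ (A.eraseIdx j ++ B)) := by
      refine Finset.sum_congr rfl fun j _ => Finset.sum_congr rfl fun q _ => ?_
      rw [prune_cons_eq _ (eraseIdx_ne_nil_of hA' j), List.append_assoc]
    have r2 : (∑ i : Fin A.length, ∑ q : {xy : Fin (A.get i).length × Fin w.length // (w.get xy.2).1 = ((A.get i).get xy.1).1},
          f (LoopSeq.prune (A.set i (mrg (A.get i) q.1.1 w q.1.2)) ++ B))
        = ∑ i : Fin A.length, ∑ q : {xy : Fin (A.get i).length × Fin w.length // (w.get xy.2).1 = ((A.get i).get xy.1).1},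
            f (A.take i ++ LoopSeq.prune [mrg (A.get i) q.1.1 w q.1.2] ++ A.drop (i + 1) ++ B) := by
      refine Finset.sum_congr rfl fun i _ => Finset.sum_congr rfl fun q _ => ?_
      rw [prune_set_eq hA']
    -- tail–tail pairs: `prune (w :: u) = w :: prune u`
    have l3 : (∑ i : Fin (A ++ B).length, ∑ j : Fin (A ++ B).length, if i = j then (0 : M) else
        ∑ q : {xy : Fin ((A ++ B).get i).length × Fin ((A ++ B).get j).length //
            (((A ++ B).get j).get xy.2).1 = (((A ++ B).get i).get xy.1).1},
          f (LoopSeq.prune (w :: ((A ++ B).set i (mrg _ q.1.1 _ q.1.2)).eraseIdx j)))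
        = ∑ i : Fin (A ++ B).length, ∑ j : Fin (A ++ B).length, if i = j then (0 : M) else
        ∑ q : {xy : Fin ((A ++ B).get i).length × Fin ((A ++ B).get j).length //
            (((A ++ B).get j).get xy.2).1 = (((A ++ B).get i).get xy.1).1},
          f (w :: LoopSeq.prune (((A ++ B).set i (mrg _ q.1.1 _ q.1.2)).eraseIdx j)) := by
      refine Finset.sum_congr rfl fun i _ => Finset.sum_congr rfl fun j _ => ?_
      split_ifs
      · rfl
      · refine Finset.sum_congr rfl fun q _ => ?_
        rw [prune_cons_of_ne_nil hw]
    have r3 : (∑ i : Fin A.length, ∑ j : Fin A.length, if i = j then (0 : M) else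
        ∑ q : {xy : Fin (A.get i).length × Fin (A.get j).length // ((A.get j).get xy.2).1 = ((A.get i).get xy.1).1},
          f (LoopSeq.prune (w :: (A.set i (mrg _ q.1.1 _ q.1.2)).eraseIdx j) ++ B))
        = ∑ i : Fin A.length, ∑ j : Fin A.length, if i = j then (0 : M) else
        ∑ q : {xy : Fin (A.get i).length × Fin (A.get j).length // ((A.get j).get xy.2).1 = ((A.get i).get xy.1).1},
          f (w :: (LoopSeq.prune ((A.set i (mrg _ q.1.1 _ q.1.2)).eraseIdx j) ++ B)) := by
      refine Finset.sum_congr rfl fun i _ => Finset.sum_congr rfl fun j _ => ?_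
      split_ifs
      · rfl
      · refine Finset.sum_congr rfl fun q _ => ?_
        rw [prune_cons_of_ne_nil hw]
        rfl
    rw [l1, l2, l3, e1, e2, h3, h2, r1, r2, r3]
    -- the right side: peel `i = 0` / `j = 0` in the two cross sums over `Fin (w :: A).length`
    have c1 : (∑ i : Fin (w :: A).length, ∑ j : Fin B.length,
        ∑ q : {xy : Fin ((w :: A).get i).length × Fin (B.get j).length // ((B.get j).get xy.2).1 = (((w :: A).get i).get xy.1).1},
          f ((w :: A).take i ++ LoopSeq.prune [mrg _ q.1.1 _ q.1.2] ++ (w :: A).drop (i + 1) ++ B.eraseIdx j))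
        = (∑ j : Fin B.length, ∑ q : {xy : Fin w.length × Fin (B.get j).length // ((B.get j).get xy.2).1 = (w.get xy.1).1},
            f (LoopSeq.prune [mrg w q.1.1 (B.get j) q.1.2] ++ (A ++ B.eraseIdx j)))
          + ∑ i : Fin A.length, ∑ j : Fin B.length,
            ∑ q : {xy : Fin (A.get i).length × Fin (B.get j).length // ((B.get j).get xy.2).1 = ((A.get i).get xy.1).1},
              f (w :: (A.take i ++ LoopSeq.prune [mrg _ q.1.1 _ q.1.2] ++ A.drop (i + 1) ++ B.eraseIdx j)) := by
      refine (Fin.sum_univ_succ (fun i : Fin (A.length + 1) => ∑ j : Fin B.length,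
        ∑ q : {xy : Fin ((w :: A).get i).length × Fin (B.get j).length // ((B.get j).get xy.2).1 = (((w :: A).get i).get xy.1).1},
          f ((w :: A).take i ++ LoopSeq.prune [mrg _ q.1.1 _ q.1.2] ++ (w :: A).drop (i + 1) ++ B.eraseIdx j))).trans ?_
      -- (`congr 1` closes the `i = i' + 1` summands by `rfl`; the `i = 0` summand needs reassociation)
      congr 1
      refine Finset.sum_congr rfl fun j _ => Finset.sum_congr rfl fun q _ => ?_
      simp only [List.append_assoc]
      rfl
    have c2 : (∑ j : Fin B.length, ∑ i : Fin (w :: A).length,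
        ∑ q : {xy : Fin (B.get j).length × Fin ((w :: A).get i).length // (((w :: A).get i).get xy.2).1 = ((B.get j).get xy.1).1},
          f ((w :: A).eraseIdx i ++ (B.take j ++ LoopSeq.prune [mrg _ q.1.1 _ q.1.2] ++ B.drop (j + 1))))
        = (∑ j : Fin B.length, ∑ q : {xy : Fin (B.get j).length × Fin w.length // (w.get xy.2).1 = ((B.get j).get xy.1).1},
            f (A ++ (B.take j ++ LoopSeq.prune [mrg _ q.1.1 _ q.1.2] ++ B.drop (j + 1))))
          + ∑ j : Fin B.length, ∑ i : Fin A.length,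
            ∑ q : {xy : Fin (B.get j).length × Fin (A.get i).length // ((A.get i).get xy.2).1 = ((B.get j).get xy.1).1},
              f (w :: (A.eraseIdx i ++ (B.take j ++ LoopSeq.prune [mrg _ q.1.1 _ q.1.2] ++ B.drop (j + 1)))) := by
      rw [← Finset.sum_add_distrib]
      refine Finset.sum_congr rfl fun j _ => ?_
      exact (Fin.sum_univ_succ (fun i : Fin (A.length + 1) =>
        ∑ q : {xy : Fin (B.get j).length × Fin ((w :: A).get i).length // (((w :: A).get i).get xy.2).1 = ((B.get j).get xy.1).1},
          f ((w :: A).eraseIdx i ++ (B.take j ++ LoopSeq.prune [mrg _ q.1.1 _ q.1.2] ++ B.drop (j + 1))))).trans rfl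
    rw [c1, c2]
    simp only [List.append_assoc, List.cons_append]
    abel

end pair

/-! ## The tree's merger sums of a concatenation -/

section instances

variable {A B : LoopSeq d} (hA : ∀ l ∈ A, l ≠ []) (hB : ∀ l ∈ B, l ≠ [])
include hA hB

/-- ★ **Negative mergers of `A ++ B`**: inside `A`, inside `B`, across with the first operand in `A`, across with the first
operand in `B`. [cite: Chatterjee2019LargeN, §2.2 (𝕄⁻(s); the merged loop replaces the first operand)] -/
theorem sum_negMergeAt_append (f : LoopSeq d → M) :
    ∑ o : MergeIdx (A ++ B), f ((A ++ B).negMergeAt o) =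
      (∑ o : MergeIdx A, f (A.negMergeAt o ++ B)) + (∑ o : MergeIdx B, f (A ++ B.negMergeAt o))
      + (∑ i : Fin A.length, ∑ j : Fin B.length,
        ∑ q : {xy : Fin (A.get i).length × Fin (B.get j).length // ((B.get j).get xy.2).1 = ((A.get i).get xy.1).1},
          f (A.take i ++ LoopSeq.prune [negMerge _ q.1.1 _ q.1.2] ++ A.drop (i + 1) ++ B.eraseIdx j))
      + ∑ j : Fin B.length, ∑ i : Fin A.length,
        ∑ q : {xy : Fin (B.get j).length × Fin (A.get i).length // ((A.get i).get xy.2).1 = ((B.get j).get xy.1).1},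
          f (A.eraseIdx i ++ (B.take j ++ LoopSeq.prune [negMerge _ q.1.1 _ q.1.2] ++ B.drop (j + 1))) := by
  have h := pairSum_append negMerge hA hB f
  have cAB := sum_mergeAt_comp negMerge f (A ++ B)
  have cA := sum_mergeAt_comp negMerge (fun u => f (u ++ B)) A
  have cB := sum_mergeAt_comp negMerge (fun u => f (A ++ u)) B
  simp only [LoopSeq.negMergeAt]
  rw [cAB, h, cA, cB]

/-- ★ **Positive mergers of `A ++ B`**. [cite: Chatterjee2019LargeN, §2.2 (𝕄⁺(s))] -/
theorem sum_posMergeAt_append (f : LoopSeq d → M) :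
    ∑ o : MergeIdx (A ++ B), f ((A ++ B).posMergeAt o) =
      (∑ o : MergeIdx A, f (A.posMergeAt o ++ B)) + (∑ o : MergeIdx B, f (A ++ B.posMergeAt o))
      + (∑ i : Fin A.length, ∑ j : Fin B.length,
        ∑ q : {xy : Fin (A.get i).length × Fin (B.get j).length // ((B.get j).get xy.2).1 = ((A.get i).get xy.1).1},
          f (A.take i ++ LoopSeq.prune [posMerge _ q.1.1 _ q.1.2] ++ A.drop (i + 1) ++ B.eraseIdx j))
      + ∑ j : Fin B.length, ∑ i : Fin A.length,
        ∑ q : {xy : Fin (B.get j).length × Fin (A.get i).length // ((A.get i).get xy.2).1 = ((B.get j).get xy.1).1},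
          f (A.eraseIdx i ++ (B.take j ++ LoopSeq.prune [posMerge _ q.1.1 _ q.1.2] ++ B.drop (j + 1))) := by
  have h := pairSum_append posMerge hA hB f
  have cAB := sum_mergeAt_comp posMerge f (A ++ B)
  have cA := sum_mergeAt_comp posMerge (fun u => f (u ++ B)) A
  have cB := sum_mergeAt_comp posMerge (fun u => f (A ++ u)) B
  simp only [LoopSeq.posMergeAt]
  rw [cAB, h, cA, cB]

end instances

end StringDuality

end Summit.QuantumFields.GaugeBoot

end
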